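import Literature.ModelTheory.ExponentialFields.OMinimalMonotonicity
import Literature.ModelTheory.ExponentialFields.Languages
import Mathlib.Topology.MetricSpace.Pseudo.Lemmas
import HarnessLib

/-!
# The monotonicity theorem over the reals and for expansions of ordered rings

Topic `Literature/ModelTheory/ExponentialFields`.  Specialisations of the monotonicity theorem
(`OMinimalMonotonicity.lean`; Pillay–Steinhorn 1986, Thm. 4.2; van den Dries 1998, Ch. 3,
(1.2)) to the settings in which it is consumed in this tree:

* `monotonicity_of_expansion` / `exists_gt_continuousOn_and_monotoneOn_or_antitoneOn_of_expansion`: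
  an o-minimal `L`-structure on a densely ordered ring-like type `M` without endpoints, where
  `L` expands the language of ordered rings `Language.orderedRing` (`Languages.lean`)
  compatibly with the given `+, *, -, 0, 1, ≤` — then `<` is `L`-definable, so the hypothesis
  `hlt` of the general theorem is discharged;
* `real_exists_gt_continuousOn_and_monotoneOn_or_antitoneOn`: the germ form over `ℝ` at the
  right of `0` — verbatim the statement `OMinimalMonotonicity` of the AnomalousDissipation /
  TameDichotomy route (van den Dries 1998, Ch. 3, (1.2), "PDF p. 60"), now a theorem.

Nothing here is a named fact.

## References

* [Dries1998] L. van den Dries, *Tame topology and o-minimal structures*, CUP 1998, Ch. 3, (1.2).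
* [PillaySteinhorn1986] A. Pillay, C. Steinhorn, *Definable sets in ordered structures I*,
  Trans. AMS 295 (1986), Thm. 4.2.
-/

open Set FirstOrder FirstOrder.Language

namespace Literature.ModelTheory.ExponentialFields

section Expansion

variable {L : Language.{0, 0}} {M : Type*} [L.Structure M] [LinearOrder M]
  [Add M] [Mul M] [Neg M] [Zero M] [One M]

/-- In an expansion of the ordered-ring structure `(M; +, *, -, 0, 1, ≤)` the strict order is
definable (van den Dries 1998, Ch. 1, (3.2), (O1)). [cite: Dries1998, Ch. 1 (3.2)] -/
theorem definable_lt_of_expansion (φ : Language.orderedRing →ᴸ L) [φ.IsExpansionOn M] :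
    (univ : Set M).Definable L {v : Fin 2 → M | v 0 < v 1} :=
  (definable_lt_of_orderedStructure (L := Language.orderedRing) (M := M)).map_expansion φ

variable [DenselyOrdered M] [NoMinOrder M] [NoMaxOrder M] [TopologicalSpace M] [OrderTopology M]

/-- **Monotonicity theorem for o-minimal expansions of ordered rings** (Pillay–Steinhorn 1986,
Thm. 4.2; van den Dries 1998, Ch. 3, (1.2)): if `L` expands the language of ordered rings on
`M` and `M` is o-minimal as an `L`-structure, every `f : M → M` with `L`-definable graph is,
off a finite set, piecewise constant or strictly monotone and continuous. [cite: Dries1998, Ch. 3 (1.2)] -/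
theorem monotonicity_of_expansion (φ : Language.orderedRing →ᴸ L) [φ.IsExpansionOn M]
    (hO : L.IsOMinimal M) {f : M → M}
    (hf : (univ : Set M).Definable L {v : Fin 2 → M | v 1 = f (v 0)}) :
    ∃ F : Finset M, ∀ c d : M, (∀ z ∈ F, z ∉ Ioo c d) →
      (∀ x ∈ Ioo c d, ∀ y ∈ Ioo c d, f x = f y) ∨
      ((StrictMonoOn f (Ioo c d) ∨ StrictAntiOn f (Ioo c d)) ∧ ContinuousOn f (Ioo c d)) :=
  monotonicity_continuousOn hO (definable_lt_of_expansion φ) hf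

/-- **Germ form** of the monotonicity theorem for o-minimal expansions of ordered rings: at the
right of every point a definable function is continuous and monotone on some open interval
(van den Dries 1998, Ch. 3, (1.2)). [cite: Dries1998, Ch. 3 (1.2)] -/
theorem exists_gt_continuousOn_and_monotoneOn_or_antitoneOn_of_expansion
    (φ : Language.orderedRing →ᴸ L) [φ.IsExpansionOn M] (hO : L.IsOMinimal M) {f : M → M}
    (hf : (univ : Set M).Definable L {v : Fin 2 → M | v 1 = f (v 0)}) (a : M) :
    ∃ δ, a < δ ∧ ContinuousOn f (Ioo a δ) ∧ (MonotoneOn f (Ioo a δ) ∨ AntitoneOn f (Ioo a δ)) :=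
  exists_gt_continuousOn_and_monotoneOn_or_antitoneOn hO (definable_lt_of_expansion φ) hf a

end Expansion

/-- **Monotonicity theorem, germ form over `ℝ`** (Pillay–Steinhorn 1986, Thm. 4.2; van den
Dries 1998, Ch. 3, (1.2)): for an o-minimal expansion `L` of the ordered field of real numbers
(an `L`-structure on `ℝ` expanding `(ℝ; +, *, -, 0, 1, ≤)`) and `g : ℝ → ℝ` with `L`-definable
graph, `g` is continuous and monotone on some interval `(0, δ)`, `δ > 0`.  This is verbatim the
statement `OMinimalMonotonicity` (input (H)) of the TameDichotomy route of the
AnomalousDissipation summit. [cite: Dries1998, Ch. 3 (1.2)] -/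
theorem real_exists_gt_continuousOn_and_monotoneOn_or_antitoneOn :
    ∀ (L : Language.{0, 0}) [L.Structure ℝ] (φ : Language.orderedRing →ᴸ L)
      [φ.IsExpansionOn ℝ], L.IsOMinimal ℝ → ∀ g : ℝ → ℝ,
      (univ : Set ℝ).Definable L {v : Fin 2 → ℝ | v 1 = g (v 0)} →
      ∃ δ : ℝ, 0 < δ ∧ ContinuousOn g (Ioo 0 δ) ∧ (MonotoneOn g (Ioo 0 δ) ∨ AntitoneOn g (Ioo 0 δ)) :=
  fun _ _ φ _ hO _ hg =>
    exists_gt_continuousOn_and_monotoneOn_or_antitoneOn_of_expansion φ hO hg 0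

end Literature.ModelTheory.ExponentialFields
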